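import Literature.IUT.HodgeTheaters.KitNFSide
import Literature.IUT.HodgeTheaters.PMBaseKitModel

/-!
# KIT-RULE witness for the `C_K`-side NF kit `NFKit` (NV-L5): an inhabitant over abc-iut-L5-t4's toy base kit
# `PMBaseKit.toyKit l` ([IUTchI] Def 4.1 (v), Ex 4.3, Ex 4.5 (i), Def 6.1 (v)) — post-freeze additive D13, not a cone member

S. Mochizuki, *Inter-universal Teichmüller theory I*, kurims manuscript (May 2020), Definition 4.1 (v) p. 97, Example 4.3
(i)–(iii) pp. 98–100, Example 4.5 (i)(ii) pp. 107–108, Definition 6.1 (v) p. 158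
([IUTchI] Def 4.1 (v) p.97) [claim: Mochizuki2012, status: disputed] (claim key; nothing of the series asserted; no side
taken on [IUTchIII] Cor. 3.12).

NV-L5 grammar: `NV-L5 PMBaseKit.NFKit WITNESSED decl PMBaseKit.NFKit.toy [degenerate]`.  The witness is DEGENERATE and
says so: over the toy kit (one valuation, ambient category the collage `loc → glob` with `Aut(glob) = AGL₁(𝔽_l)`), the
`C_K`-side category is the kit's own one-object global category (`projAt = 𝟙`, the "double covering" collapsed), every
label torsor is `𝔽_l^⋇` acting on itself, `𝕍(†𝒟^⊚) = Unit`, and the label pull-back along a morphism `loc → glob`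
with affine part `(b, a)` is right multiplication by the class `[a] ∈ 𝔽_l^⋇`; the laws of `NFKit` then hold by
commutativity of `𝔽_l^⋇`.  Its only purpose is to certify that the axioms of `NFKit` are jointly satisfiable over an
inhabited base kit (for every prime `l ≠ 2`); it is not a model of number-field arithmetic.
-/

namespace Literature.IUT.HodgeTheaters

open CategoryTheory

namespace PMBaseKit

namespace NFKitToy

open Model

variable (l : ℕ)

/-- `AGL₁(𝔽_l) → 𝔽_l^⋇`, `(b, a) ↦ [a]` (the toy's `Aut(𝒟^⊚) ↠ 𝔽_l^⋇`, Ex 4.3 (i)). (model plumbing for [IUTchI] Ex 4.3 (i) p.98) [claim: Mochizuki2012, status: disputed] -/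
def aglToFlStar : AGL l →* FlStar l :=
  (QuotientGroup.mk' (unitsPlusMinus l)).comp SemidirectProduct.rightHom

/-- (model plumbing) signs die in `𝔽_l^⋇ = 𝔽_l^× / {±1}`. [folklore] -/
private theorem aglToFlStar_signToAGL (ε : ℤˣ) : aglToFlStar l (signToAGL l ε) = 1 := by
  have hmem : (Units.map (Int.castRingHom (ZMod l)).toMonoidHom ε) ∈ unitsPlusMinus l := by
    rw [mem_unitsPlusMinus_iff]
    rcases Int.units_eq_one_or ε with rfl | rfl
    · exact Or.inl (by simp)
    · exact Or.inr (Units.ext (by simp))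
  simpa [aglToFlStar, signToAGL] using (QuotientGroup.eq_one_iff _).mpr hmem

/-- "What a morphism of the collage does on `𝔽_l^⋇`-labels": the class of its affine part (`1` on `loc → loc`).
(model plumbing for [IUTchI] Ex 4.5 (i) p.107) [claim: Mochizuki2012, status: disputed] -/
def homStar : ∀ {X Y : Obj l}, (X ⟶ Y) → FlStar l
  | .loc, .loc, _ => 1
  | .loc, .glob, f => aglToFlStar l f
  | .glob, .glob, f => aglToFlStar l f
  | .glob, .loc, f => f.elim

/-- (model plumbing) `homStar` is anti-multiplicative (composition is read right-to-left). [folklore] -/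
private theorem homStar_comp {X Y Z : Obj l} (f : X ⟶ Y) (g : Y ⟶ Z) :
    homStar l (f ≫ g) = homStar l g * homStar l f := by
  rcases X with _ | _ <;> rcases Y with _ | _ <;> rcases Z with _ | _
  · exact (mul_one (1 : FlStar l)).symm
  · exact ((aglToFlStar l).map_mul g (signToAGL l f)).trans
      (congrArg (fun t => aglToFlStar l g * t) (aglToFlStar_signToAGL l f))
  · exact g.elim
  · exact (aglToFlStar l).map_mul g f
  · exact f.elim
  · exact f.elim
  · exact g.elim
  · exact (aglToFlStar l).map_mul g f

/-- (model plumbing) `homStar` of an identity. [folklore] -/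
private theorem homStar_id (X : Obj l) : homStar l (𝟙 X) = 1 := by
  rcases X with _ | _
  · rfl
  · exact map_one (aglToFlStar l)

/-- (model plumbing) local objects of the toy kit are `loc`: an isomorphism between local objects has trivial
`homStar`. [folklore] -/
private theorem homStar_local [Fact l.Prime] (hl : l ≠ 2) {x : (toyKit l hl).V} {X Y : (toyKit l hl).LocalObj x}
    (a : X ≅ Y) : homStar l a.hom.hom = 1 := by
  obtain ⟨X, ⟨eX⟩⟩ := X
  obtain ⟨Y, ⟨eY⟩⟩ := Y
  rcases X with _ | _ <;> rcases Y with _ | _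
  · rfl
  · exact (eY.hom : PEmpty).elim
  · exact (eX.hom : PEmpty).elim
  · exact (eX.hom : PEmpty).elim

/-- (model plumbing) right multiplication in a commutative group commutes with the left regular action. [folklore] -/
private theorem mulRight_smul {G : Type} [CommGroup G] (h j c : G) :
    Equiv.mulRight h (j • c) = j • Equiv.mulRight h c := by
  simp [smul_eq_mul, mul_assoc]

/-- (model plumbing) [folklore] -/
private theorem law_trans {G : Type} [CommGroup G] (x y c : G) : c * (y * x) = c * x * y := by
  rw [mul_comm y x, mul_assoc]

/-- (model plumbing) [folklore] -/
private theorem law_inv {G : Type} [CommGroup G] (x y c : G) : c * (y * x)⁻¹ = c * y⁻¹ * x⁻¹ := by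
  rw [mul_inv_rev, mul_comm x⁻¹, mul_assoc]

/-- (model plumbing) the automorphism `(0, u)` of the toy `𝒟^⊚` has class `[u]`. [folklore] -/
private theorem aglToFlStar_inr (u : (ZMod l)ˣ) : aglToFlStar l (SemidirectProduct.inr u) = (u : FlStar l) := by
  simp [aglToFlStar]

end NFKitToy

open Model NFKitToy

variable (l : ℕ)

/-- **The toy `NFKit`** over abc-iut-L5-t4's `toyKit l` (DEGENERATE KIT-RULE witness — see the module docstring:
`projAt = 𝟙`, all torsors `𝔽_l^⋇` on itself, label pull-back = right multiplication by the class of the affine part; v3,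
against the v2 fields of `NFKit`).
([IUTchI] Def 4.1 (v) p.97) [claim: Mochizuki2012, status: disputed] -/
noncomputable def NFKit.toy [Fact l.Prime] (hl : l ≠ 2) : (toyKit l hl).NFKit where
  GlobNF := SingleObj (AGL l)
  gnfModel := SingleObj.star _
  gnf_iso _ _ := ⟨Iso.refl _⟩
  nfAtV _ := atV' l
  projAt _ := 𝟙 _
  phiNF _ := (1 : AGL l)
  phiNF_eq _ := show (1 : AGL l) = 1 * 1 by simp
  Val _ := Unit
  valIso _ := Equiv.refl _
  valIso_refl _ := rfl
  valIso_trans _ _ := rfl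
  valOfV := ⟨fun _ => (), fun _ _ _ => rfl⟩
  GLabNF _ := FlStar l
  isTorsor_gLabNF _ := IsTorsor.self
  gLabNFMap b := Equiv.mulRight (aglToFlStar l b.hom)
  gLabNFMap_smul b j c := mulRight_smul _ j c
  gLabNFMap_refl _ := Equiv.ext fun c => (congrArg (fun t => c * t) (map_one (aglToFlStar l))).trans (mul_one c)
  gLabNFMap_trans b b' := Equiv.ext fun c =>
    (congrArg (fun t => c * t) ((aglToFlStar l).map_mul b'.hom b.hom)).trans (law_trans _ _ c)
  εLab := 1
  exists_aut_smul j := by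
    obtain ⟨u, rfl⟩ := QuotientGroup.mk_surjective j
    refine ⟨⟨SemidirectProduct.inr u, SemidirectProduct.inr u⁻¹, ?_, ?_⟩, fun c => ?_⟩
    · simp [SingleObj.comp_as_mul, SingleObj.id_as_one]
    · simp [SingleObj.comp_as_mul, SingleObj.id_as_one]
    · exact (congrArg (fun t => c * t) (aglToFlStar_inr l u)).trans
        ((mul_comm c _).trans (smul_eq_mul _ c).symm)
  LabStar _ _ := FlStar l
  isTorsor_labStar _ _ := IsTorsor.self
  labStarIso a := Equiv.mulRight (homStar l a.hom.hom)
  labStarIso_smul a j c := mulRight_smul _ j c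
  labStarIso_refl X := Equiv.ext fun c => (congrArg (fun t => c * t) (homStar_id l X.obj)).trans (mul_one c)
  labStarIso_trans f g := Equiv.ext fun c =>
    (congrArg (fun t => c * t) (homStar_comp l f.hom.hom g.hom.hom)).trans (law_trans _ _ c)
  ηStar _ _ := 1
  labStarIso_η a := (congrArg (fun t => (1 : FlStar l) * t) (homStar_local l hl a)).trans (mul_one 1)
  labPull f := Equiv.mulRight (homStar l f)⁻¹
  labPull_smul f j c := mulRight_smul _ j c
  labPull_pre a f c := (congrArg (fun t => c * t⁻¹) (homStar_comp l a.hom.hom f)).trans (law_inv _ _ c)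
  labPull_post f b c :=
    (congrArg (fun t => c * t⁻¹) (homStar_comp l f ((atV' l).map b.hom))).trans (law_inv _ _ c)
  labPull_phiNF_εLab _ :=
    (congrArg (fun t => (1 : FlStar l) * t⁻¹) (map_one (aglToFlStar l))).trans (by simp)

/-- **NV-L5 `PMBaseKit.NFKit` WITNESSED [degenerate]**: the NF kit interface is inhabited over an inhabited base kit,
for every prime `l ≠ 2`. ([IUTchI] Def 4.1 (v) p.97) [claim: Mochizuki2012, status: disputed] -/
theorem NFKit.nonempty_toy [Fact l.Prime] (hl : l ≠ 2) : Nonempty ((toyKit l hl).NFKit) := ⟨NFKit.toy l hl⟩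

end PMBaseKit

end Literature.IUT.HodgeTheaters
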